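import Mathlib
import Summits.Schanuel.Schanuel.Theses.RigidCore
import Summits.Schanuel.Schanuel.Theses.GaussianStokesSector
import Summits.Schanuel.Schanuel.Theses.ExceptionalSubspaces
import Literature.NumberTheory.Transcendental.PeriodsWave0
import Literature.NumberTheory.Transcendental.GelfondDiazHolds
import Summits.Schanuel.Schanuel.Theorems.RigidCoreSchanuelOnLogFreeCoreSectorGlue
import Summits.Schanuel.Schanuel.Theorems.RigidCoreSchanuelOnLogFreeCoreSectorSplit
import Summits.Schanuel.Schanuel.Theorems.RigidCoreSchanuelOnLogFreeCoreAxesSplit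
import Summits.Schanuel.Schanuel.Theorems.RigidCoreSchanuelOnLogFreeCoreCoreRelOfRelSchanuel
import Summits.Schanuel.Schanuel.Theorems.RigidCoreSchanuelOnLogFreeCoreCoreRelCalibration
import Summits.Schanuel.Schanuel.Theorems.RigidCoreSchanuelOnLogFreeCoreSectorExactness
import Summits.Schanuel.Schanuel.Theorems.RigidCoreSchanuelOnLogFreeCoreAnchorAxesReduction
import Summits.Schanuel.Schanuel.Theorems.RigidCoreSchanuelOnLogFreeCoreConjugationOffAxes
import Summits.Schanuel.Schanuel.Theorems.RigidCoreSchanuelOnLogFreeCoreConjNormTransfer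
import Summits.Schanuel.Schanuel.Theorems.RigidCoreSchanuelOnLogFreeCoreOnAxesExpField
import Summits.Schanuel.Schanuel.Theorems.RigidCoreSchanuelOnLogFreeCorePiExpOfRe
import Summits.Schanuel.Schanuel.Theorems.RigidCoreSchanuelOnLogFreeCoreBWBridge
import Summits.Schanuel.Schanuel.Theorems.RigidCoreSchanuelOnLogFreeCoreDiazLadder
import Summits.Schanuel.Schanuel.Theorems.RigidCoreSchanuelOnLogFreeCoreDiazLadderCell
import Literature.NumberTheory.Transcendental.DiazMainHolds
import Summits.Schanuel.Schanuel.Theorems.RigidCoreSchanuelOnLogFreeCoreDiazAnyBase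
import Summits.Schanuel.Schanuel.Theorems.RigidCoreSchanuelOnLogFreeCoreNesterenkoImagAxis
import Summits.Schanuel.Schanuel.Theorems.RigidCoreSchanuelOnLogFreeCoreCruxCellPiIOfReSqrt
import Summits.Schanuel.Schanuel.Theorems.RigidCoreSchanuelOnLogFreeCoreCruxCellThroughPiSqrt
import Summits.Schanuel.Schanuel.Theorems.RigidCoreSchanuelOnLogFreeCorePiPowersTH
import Summits.Schanuel.Schanuel.Theorems.RigidCoreSchanuelOnLogFreeCoreCalibrationR
import Literature.Barriers.Schanuel.LargeTranscendenceDegreeHolds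
import Literature.NumberTheory.Transcendental.ExpOneTranscendenceMeasureProofs
import Summits.Schanuel.Schanuel.Theorems.RigidCoreSchanuelOnLogFreeCoreExpOnePowersTH
import Summits.Schanuel.Schanuel.Theorems.RigidCoreSchanuelOnLogFreeCorePiRealPowersTH
import Summits.Schanuel.Schanuel.Theorems.RigidCoreSchanuelOnLogFreeCorePiRealGridBound
import Summits.Schanuel.Schanuel.Theorems.RigidCoreSchanuelOnLogFreeCoreSmallGridPowerCell
import Summits.Schanuel.Schanuel.Theorems.RigidCoreSchanuelOnLogFreeCoreExpAlgPowers
import Summits.Schanuel.Schanuel.Theorems.RigidCoreSchanuelOnLogFreeCoreTowerReduction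
import Summits.Schanuel.Schanuel.Theorems.RigidCoreSchanuelOnLogFreeCoreRelLWZeroOfCrux
import Summits.Schanuel.Schanuel.Theorems.RigidCoreSchanuelOnLogFreeCoreRelLWStepOfCrux
import Summits.Schanuel.Schanuel.Theorems.AclSubsetLogFreeCore.Negative.LogFreeCoreCountable
import Summits.Schanuel.Schanuel.Theorems.AclSubsetLogFreeCore.Negative.RealDefinableCalibration
import Summits.Schanuel.Schanuel.Theorems.AclSubsetLogFreeCore.Negative.LogTwoHub
import Literature.NumberTheory.Transcendental.BakerCoefficientForm
import Summits.Schanuel.Schanuel.Theorems.RigidCoreSchanuelOnLogFreeCoreBakerLayerOne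
import Summits.Schanuel.Schanuel.Theorems.RigidCoreSchanuelOnLogFreeCoreRealUndefinable
import Summits.Schanuel.Schanuel.Theorems.RigidCoreSchanuelOnLogFreeCoreLogFreeOfCrux
import Summits.Schanuel.Schanuel.Theorems.RigidCoreSchanuelOnLogFreeCoreCoreHL
import Summits.Schanuel.Schanuel.Theorems.RigidCoreSchanuelOnLogFreeCoreFixedPointCoreHL
import Summits.Schanuel.Schanuel.Theorems.RigidCoreSchanuelOnLogFreeCoreLogPiCoreHL
import Summits.Schanuel.Schanuel.Theorems.RigidCoreSchanuelOnLogFreeCoreExpTower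
import Summits.Schanuel.Schanuel.Theorems.RigidCoreSchanuelOnLogFreeCorePiTower

/-!
# Skeleton v27 — crux stmt-Schanuel-0970 `RigidCore.SchanuelOnLogFreeCore` (R), line `sector-split`
# (lead c12, 2026-08-17; v23 = c11's registered v22 + THREE new stubs C19–C21: the crux's sharpest
# qualitative PREDICTION — "the log-free core is log-free", `(R) ⟹ C_EA ∩ exp⁻¹(ℚ̄) = ℚ·2πi` (C20, lead,
# over lead c2's LANDED relative-Lindemann–Weierstrass layers) — its UNCONDITIONAL first layer by Baker's
# theorem (C19, worker: `(ℚ̄ ⊕ ℚ̄·2πi) ∩ exp⁻¹(ℚ̄) = ℚ·2πi`), and the route-internal consequence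
# `(A) ∧ (R) ⟹ ℝ is not ∅-definable in ℂ_exp` (C21, worker, over the (A)-disprover's LANDED
# `log_two_mem_logFreeCore_of_real_definable`);
# v24: ALL THREE LANDED — p160798 C19 `…BakerLayerOne.lean`, p161494 C20 `…LogFreeOfCrux.lean`,
# p160770 C21 `…RealUndefinable.lean`; v23b (registered) added wave-2 stubs C22–C24 — core Hermite–Lindemann
# under (R): `u ∈ C_EA`, `eᵘ` algebraic over `ℚ(2πi, u)` ⟹ `u ∈ ℚ·2πi` (C22, lead), hence no fixed point of
# `exp` (C23, worker) and no logarithm of `π` (C24, worker) in the core; v25: ALL SIX LANDED — p162545 C22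
# `…CoreHL.lean`, p162223 C23 `…FixedPointCoreHL.lean`, p162391 C24 `…LogPiCoreHL.lean` — and imported under
# their registered names; v26 = v25 + wave-3 stubs C25 `stub_expTower_of_crux` (lead) / C26 `stub_piTower_of_crux`
# (worker): (R) ⟹ the towers π, e, e^e, … and π, e^π, e^{e^π}, … are algebraically independent;
# v27: BOTH LANDED — p163638 C25 `…ExpTower.lean`, p163466 C26 `…PiTower.lean` — and imported by name;
# composition unchanged, sorries = the two residues only; NINE stubs of this seat landed in all)

(R): Schanuel's conjecture for `ℚ`-linearly independent tuples from the log-free core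
`C_EA = sInf {K ≤ ℂ | 2πi ∈ K, K exp-closed, K relatively algebraically closed}`.

## What is new in v23 (lead c12)

Seats c4–c11 mined CREDITS (settled cells, grid counts).  v23 types the crux's sharpest qualitative
prediction and its unconditional shadow.  Finding I7 (`Ideas/finding-r-implies-pilogalgindep.md`:
"(R) ⟹ the log-free core is log-free") was never landed — `…CalibrationR.lean` proves only the
dichotomy corollary `(R) ⟹ π ⊥ log 2`.

* C20 `stub_logFree_of_crux` (lead): `(R) ⟹ ∀ u ∈ C_EA, e^u ∈ ℚ̄ → u ∈ ℚ·2πi`.  Induction up the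
  kernel tower `stage` (`C_EA = ⋃ₘ stage m`, tree `mem_logFreeCore_iff_exists_stage`): at level `0`
  the `r = 1` layer of RelLW₀ (`stub_relLWZero_of_crux` p107727 through `KernelTower.relLWZero_one_iff`)
  says `a ∈ L₀, eᵃ ∈ L₀ ⟹ a ∈ ℚ·2πi`; at level `m + 1` the `r = 1` layer of RelLW_{m+1}
  (`stub_relLWStep_of_crux` p107397) says `eᵘ` is transcendental over `stage (m+1)` unless
  `u ∈ stage m` — so an algebraic `eᵘ` drops the level.  Consequences (landed with C20 as
  `LogFreeOfCrux.*`, restated below by name): under (R), `log α ∉ C_EA` for every algebraic `α` and every branch outside `ℚ·2πi`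
  (`ln 2`, `ln 3`, `iπ/… + ln 2`, …); the only kernel-adjacent algebraic values of `exp` on the core are
  the roots of unity.
* C19 `stub_bakerLayerOne` (worker): UNCONDITIONALLY, for algebraic `α, β`,
  `e^{α + β·2πi} ∈ ℚ̄ ⟹ α = 0 ∧ β ∈ ℚ` — Baker 1975 Thm 2.1 in the tree's coefficient form
  (`Literature.NumberTheory.Transcendental.baker_coeff_eq_zero`, PROVED over `baker_holds`) at
  `l = (2πi, α + β·2πi)` plus `transcendental_two_pi_I`.  So the first layer `E = ℚ̄ ⊕ ℚ̄·2πi ⊂ C_EA`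
  of the core satisfies C20's conclusion with no hypothesis (`LogFreeOfCrux`-shape example below), correcting
  STRATEGY-CENSUS §2.3 ("on core data Baker's statement is empty … unconditionally nothing more is
  known to be excluded"); the NEXT layer `stage 0 = ℚ(2πi)^{ralg}` is exactly the printed-open
  `π ⊥ log α` (CalibrationR; barrier `AlgebraicIndependenceOfLogarithms`), so C19 is the exact
  unconditional reach.
* C21 `stub_realUndefinable_of_logFree` (worker; takes C20's conclusion as an explicit hypothesis so
  the wave runs in parallel): log-freeness of the core + (A) `AclSubsetLogFreeCore` ⟹ `ℝ ⊆ ℂ` is NOT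
  `∅`-definable in `ℂ_exp` (the (A)-disprover's `log_two_mem_logFreeCore_of_real_definable` puts
  `ln 2 ∈ C_EA` under (A) + `Def_∅(ℝ)`; `ln 2 ∉ ℚ·2πi`).  Composed (`LogFreeOfCrux.real_not_definable_of_cruxes`, p161494):
  **(A) ∧ (R) ⟹ ¬Def_∅(ℝ)** (Koiran's 2003 conjecture, parameter-free case; KMO arXiv:1101.4224 p. 2:
  open), `ln 2 ∉ dcl ∅`, no branch of `log 2` in `acl ∅` — the route's informal kill criterion for (A)
  (item stmt-Schanuel-0968: "false if ℝ is ∅-definable … under SC") with SC replaced by the route's own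
  (R), kernel-checked.

None of C19–C21 touches the residues (open-problem strength, unchanged).

## What was new in v21 (lead c11)

The tree PROVES the Nesterenko–Waldschmidt 1996 transcendence measure of `e`
(`Literature.NumberTheory.Transcendental.NesterenkoWaldschmidt1996_thm_4_2_holds`:
`|P(e)| ≥ exp(−1.3·10⁵ d² (log L + d))` for `P ∈ ℤ[X] ∖ 0`, `deg P ≤ d`, `L(P) ≤ L`, `L ≥ 3`), used
under `Summits/` so far only by crux EPiSimultaneousType.  A polynomial lower bound for
`|∑ hᵢ eⁱ|` in terms of `∑ |hᵢ|` is exactly what the tree's `TechnicalHypothesis.of_lowerBound`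
turns into the Technical Hypothesis (LNM 1752 Ch. 14 Def. 2.6) for `(1, e, …, e^{d−1})` — stub C12
`stub_expOnePowersTH` — and then the tree's PROVED clause `t₂` of Diaz's Theorem 2.7
(`Literature.Barriers.Schanuel.ceil_le_trdeg_gridField₂`) on the grid `x = (eⁱ)_{i<d}`,
`y = (eʲ)_{j<ℓ}` (`d + ℓ < dℓ`) gives, unconditionally,
`⌈dℓ/(d+ℓ)⌉ ≤ trdeg ℚ(e, e^e, e^{e²}, …, e^{e^{d+ℓ−2}})` — stub C13 `stub_expOneGridBound`
(both held by the lead; this is the `e`-analogue of lead c2's kernel Hankel bound p107393 for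
`2πi`).  E.g. `(d, ℓ) = (4, 5)`: THREE of `e, e^e, …, e^{e⁷}` are algebraically independent
(`(2, 3)`: two of `e, e^e, e^{e²}, e^{e³}`, already Theorem 2.9 without (T.H.); `(6, 7)`: four of
`e, …, e^{e^{11}}`).  The (R)-cells are the `ℚ`-free core tuples `z_N = (1, e, …, e^{N−1})`, on
which (R) demands `N` (`expOnePowers_demand_of_crux` below, by the crux's name) and the grid
supplies `≈ (N+1)/4`.  Stubs C14 `stub_piRealPowersTH` / C15 `stub_piRealGridBound` (wave 1, two
stub-workers; C15 takes C14's statement as an explicit hypothesis) do the same on the REAL powers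
of `π` — (T.H.) for `(1, π, …, π^{d−1})` from Baker's `|π − β| > B^{−C}` (the `pi_case` lead c2 read
off `baker1975_thm_3_1_holds`, there spent on `2πi`, whose slot `k = 1` is the wasted `e^{2πi} = 1`)
— giving `⌈dℓ/(d+ℓ)⌉ ≤ trdeg ℚ(π, e, e^π, e^{π²}, …, e^{π^{d+ℓ−2}})`, e.g.
`3 ≤ trdeg ℚ(π, e, e^π, e^{π²}, …, e^{π⁷})`: since `trdeg ℚ(π, e^π) = 2` (Nesterenko), not all of
`e, e^{π²}, …, e^{π⁷}` are algebraic over `ℚ(π, e^π)` (the first cells `e ⊥ π`, `e^{π²} ∉ ℚ̄` of the two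
residues stay open).  None of C12–C15 touches the residues.

## Inherited from v19/v20 (lead c10)

Leads c6–c9 recorded Nesterenko's theorem as exhausted at the two elliptic points `τ = i, ρ`
(`nesterenko_holds`, `nesterenko'_holds`: cells `(πi, u)` with `Re u ∈ ℚ*π ∪ ℚ*π√3`, p142551), the
general CM point "needing Chowla–Selberg values of `E₂, E₄, E₆` that the tree does not hold"
(LINE-SUMMARY-c9 §3; STRATEGY-CENSUS §2.2 "breaks at complex multiplication").  It does not: the
tree PROVES (i) Nesterenko's Theorem 1.1 for every `0 < |q| < 1`
(`Literature.Barriers.Schanuel.nesterenko1996_thm_1_1_holds`), (ii) `E₂ = P(q), E₄ = Q(q), E₆ = R(q)`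
(`ramanujanP_cexp` …), (iii) `j(τ)` is an algebraic integer for every imaginary quadratic `τ`
(`Literature.NumberTheory.EllipticCurves.isIntegral_int_kleinJ_of_quadratic`, Cox Thm 11.1), (iv)
Masser's CM quasi-period relation `A η₁ω₁ − s ω₁² = K·2πi` with `A, s, K` algebraic for every CM
lattice with algebraic invariants (`MasserCM.cm_quasiPeriod_relation`, LNM 437 Lemma 3.1), (v)
`η = G₂(τ)/ω` (`PeriodPair.η₁_eq_G2_div`) and `g₂(Λ_τ) = (4π⁴/3)E₄(τ)`, `g₃(Λ_τ) = (8π⁶/27)E₆(τ)`.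
At `τ = i√d`: rescale `Λ_τ` to algebraic `g₂, g₃` (possible since `j(τ) ∈ ℚ̄`), then (iv)+(v) put
`E₂(τ) ∈ ℚ̄(π, ω)`, `E₄(τ) ∈ ℚ̄·(ω/π)⁴`, `E₆(τ) ∈ ℚ̄·(ω/π)⁶`, so `ℚ(q, P, Q, R) ⊆ ℚ̄(q, π, ω)` with
`q = e^{−2π√d}`, and (i) gives `trdeg ℚ(q, π, ω) = 3`: **`π`, `e^{π√d}` (and the CM period `ω`) are
algebraically independent for every `d ≥ 1`** (LNM 1752 Ch. 1 Cor. 3.2 without naming the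
Γ-product) — stub C9 `stub_nesterenkoImagAxis`, held by the lead, LANDED p154463 (370 lines).  Its
(R)-cells (stubs C10, C11, workers; both take C9's statement as an explicit hypothesis): every core
pair `(πi, u)` with `Re u ∈ ℚ*·π√d` (conjugate-norm device of p142551) — LANDED p154223 — and every
pair through a point of `ℚ*·π√d` (generalising the disprover's `rank_two_through_pi`, `d = 1`) —
LANDED p154346.  New settled cells, e.g. `(πi, π√2)`, `(π√2, 1)`, `(π√5, e)`, `(πi, π√7/3 + i)`;
`d = 1, 3` recover c6's cells.

Open after C9–C11 landed = unchanged: the two residues = items stmt-Schanuel-9545 / stmt-Schanuel-9548|core.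

## Inherited from v18 (c8; re-registered unchanged by c9)

Line `sector-split` (crux-strategist's split (S); leads c4–c7): `(R) ⟺ PiFreeOverLWField ∧ CoreRel`
kernel-exactly (`stub_sectorSplitExact` p138589, `stub_axesSplitExact` p140637), all glue landed and
imported above.  v18 = v17 with its calibration stub C8 LANDED (p148947
`…DiazAnyBase.lean`) and imported under its registered name; v17 = c7's registered v16c with

* BOTH Gel'fond–Diaz calibration files of c7 imported under their landed names (p145740
  `…DiazLadder.lean` = C6 `stub_diazLadderCount`; p145934 `…DiazLadderCell.lean` = C7
  `stub_diazLadder_coreCell`, which v16c could only cite because the farm had not built it), so the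
  ladder's (R)-demand `diazLadder_demand_of_crux` ((R) ⟹ `d - 1 ≤ trdeg` on the ladder) is now a
  theorem of the skeleton BY NAME;
* RESIDUE 1 = item stmt-Schanuel-9545 VERBATIM (`GaussianStokesSector.PiFreeOverLWField`; own line
  `Cruxes/PiFreeOverLWField/Lines/birth.lean` since 05:26Z, nothing served on it since);
* RESIDUE 2 = item stmt-Schanuel-9548 restricted to core tuples (own line `Lines/birth.lean` since
  05:23Z; fed verbatim by `stub_coreRel_of_relSchanuel` p137556);
* ONE new provable CALIBRATION stub C8 `stub_diazLadder_anyCoreBase`: Diaz 1989 **Corollaire 1**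
  (the ladder at an ARBITRARY base, PROVED in the tree as
  `Literature.NumberTheory.Transcendental.Diaz1989_cor1_holds`, so far unused under `Summits/`):
  for EVERY nonzero `l ∈ C_EA` and every `β` algebraic of degree `d ≥ 2`, the full ladder
  `x = (β^k · l)_{0 ≤ k < d}` is a `ℚ`-free core tuple of (R)-demand `d` on which
  `⌊(d+1)/2⌋ ≤ trdeg ℚ(x, e^x)` holds unconditionally — Gel'fond–Diaz half-credit THROUGH EVERY
  CORE POINT (c7's C6/C7 are the base `l = rπi`, where the rung `k = 0` has algebraic exponential and
  is dropped, giving the fraction `⌊(d+1)/2⌋/(d-1)`, full for `d = 3`; at a general core base the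
  fraction is `⌊(d+1)/2⌋/d`: e.g. `l = e`, `β = 2^{1/3}`: two of `e^e, e^{∛2·e}, e^{∛4·e}` are
  algebraically independent; `l = π²`: two of `e^{π²}, e^{∛2π²}, e^{∛4π²}` — while `e^e ∉ ℚ̄`,
  `e^{π²} ∉ ℚ̄` themselves are open first cells of residue 2).

Composition: `SchanuelOnLogFreeCore_of = stub_sectorGlue stub_piFreeOverLWField
stub_coreRelSchanuelOverPiLWField` concludes the crux BY NAME.  Open after C8 lands = the two
residues = items stmt-Schanuel-9545 and stmt-Schanuel-9548|core.
-/

noncomputable section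

namespace Summit.Schanuel.Schanuel.Theorems.RigidCore

open Summit.Schanuel.Schanuel.Theses

/-- RESIDUE 1 (open-problem strength) — VERBATIM the ledger item stmt-Schanuel-9545
`PiFreeOverLWField`: for `ℚ`-linearly independent algebraic `a₁,…,a_d`,
`trdeg ℚ(π, e^{a₁},…,e^{a_d}) ≥ d + 1` (π is transcendental over the Lindemann–Weierstrass field).
Contains `e ⊥ π` (`d = 1, a = (1)`).  Kernel-equivalent to the on-axes form `PiFreeOnAxes` of v6–v14
(`AxesSplit.piFreeOverLWField_iff_onAxes`, p140637); implied by (R) (p109943). -/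
theorem stub_piFreeOverLWField : GaussianStokesSector.PiFreeOverLWField := by
  sorry

/-- RESIDUE 2 (open, unchanged since v1): relative Schanuel over the π–LW field
`K₂ = ℚ(ℚ̄ ∪ {πi} ∪ e^{ℚ̄})` for CORE tuples free modulo `V₂ = span_ℚ(ℚ̄ ∪ {πi})`
(item stmt-Schanuel-9548 restricted to the core; fed from the item by `stub_coreRel_of_relSchanuel`,
p137556). Contains `e^{π²}, e^e ∉ ℚ(π, e^{ℚ̄})^{alg}` (`stub_coreRel_calibration`, p138574). -/
theorem stub_coreRelSchanuelOverPiLWField :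
    ∀ (n : ℕ) (x : Fin n → ℂ),
      (∀ i, x i ∈ (sInf {K : IntermediateField ℚ ℂ | (2 * ↑Real.pi * Complex.I : ℂ) ∈ K ∧
        (∀ w ∈ K, Complex.exp w ∈ K) ∧ ∀ w : ℂ, IsAlgebraic K w → w ∈ K} : IntermediateField ℚ ℂ)) →
      LinearIndependent ℚ ((Submodule.span ℚ ({z : ℂ | IsAlgebraic ℚ z} ∪ {(Real.pi : ℂ) * Complex.I})).mkQ ∘ x) →
      (n : Cardinal) ≤ Algebra.trdeg
        ↥(IntermediateField.adjoin ℚ ({z : ℂ | IsAlgebraic ℚ z} ∪ {(Real.pi : ℂ) * Complex.I} ∪ Complex.exp '' {z : ℂ | IsAlgebraic ℚ z}))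
        ↥(IntermediateField.adjoin ↥(IntermediateField.adjoin ℚ ({z : ℂ | IsAlgebraic ℚ z} ∪ {(Real.pi : ℂ) * Complex.I} ∪ Complex.exp '' {z : ℂ | IsAlgebraic ℚ z})) (Set.range x ∪ Set.range (Complex.exp ∘ x))) := by
  sorry

/-- COMPOSITION: the landed glue `stub_sectorGlue` (p137998) applied to the two residues concludes
the crux BY NAME. -/
theorem SchanuelOnLogFreeCore_of : RigidCore.SchanuelOnLogFreeCore :=
  stub_sectorGlue stub_piFreeOverLWField stub_coreRelSchanuelOverPiLWField

/-! ### Stubs C19–C21 (v23, lead c12) — ALL LANDED (v24) and imported above under their registered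
names: the log-free core is log-free — under (R) at every level of the kernel tower (C20, p161494),
unconditionally on its first layer (C19, Baker, p160798), and what that does to the symmetry crux (A):
`(A) ∧ (R) ⟹ ℝ is not ∅-definable in ℂ_exp` (C21, p160770).  The `example`s restate each registered
signature verbatim and close it by the landed name. -/

section LogFreeStubs

open Summit.Schanuel.Schanuel.Theorems.AclSubsetLogFreeCore.Negative

/-- **C19 `stub_bakerLayerOne`** (wave 1, worker; LANDED p160798 `…BakerLayerOne.lean`): for algebraic
`α, β`, `e^{α + β·2πi} ∈ ℚ̄ ⟹ α = 0 ∧ β ∈ ℚ` — Baker 1975 Thm 2.1 (`baker_coeff_eq_zero`) at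
`(2πi, α + β·2πi)` + `transcendental_two_pi_I`. [cite: BakerTNT1975, Ch. 2 Thm 2.1] -/
example :
    ∀ α β : ℂ, IsAlgebraic ℚ α → IsAlgebraic ℚ β →
      IsAlgebraic ℚ (Complex.exp (α + β * (2 * ↑Real.pi * Complex.I))) →
      α = 0 ∧ β ∈ Set.range ((↑) : ℚ → ℂ) :=
  stub_bakerLayerOne

/-- **C20 `stub_logFree_of_crux`** (lead; LANDED p161494 `…LogFreeOfCrux.lean`): (R) ⟹ every
`u ∈ C_EA` with `eᵘ` algebraic lies on `ℚ·2πi` (induction up `stage`: `LogFreeOfCrux.level_zero` =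
`r = 1` layer of `stub_relLWZero_of_crux`, `LogFreeOfCrux.level_succ` = `r = 1` layer of
`stub_relLWStep_of_crux` drops the level). [cite: Kirby2010, Prop. 7.2] -/
example :
    RigidCore.SchanuelOnLogFreeCore →
      ∀ u : ℂ, u ∈ logFreeCore → IsAlgebraic ℚ (Complex.exp u) →
        u ∈ Submodule.span ℚ ({(2 * ↑Real.pi * Complex.I : ℂ)} : Set ℂ) :=
  stub_logFree_of_crux

/-- **C21 `stub_realUndefinable_of_logFree`** (wave 1, worker; LANDED p160770 `…RealUndefinable.lean`):
log-freeness + (A) ⟹ `ℝ ⊆ ℂ` is not `∅`-definable in `ℂ_exp`. [cite: KirbyMacintyreOnshuus2012, p. 2] -/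
example :
    (∀ u : ℂ, u ∈ logFreeCore → IsAlgebraic ℚ (Complex.exp u) →
        u ∈ Submodule.span ℚ ({(2 * ↑Real.pi * Complex.I : ℂ)} : Set ℂ)) →
      RigidCore.AclSubsetLogFreeCore →
        ¬ Set.Definable₁ (∅ : Set ℂ) Literature.ModelTheory.ExponentialFields.Language.expRing
            (Set.range ((↑) : ℝ → ℂ)) :=
  stub_realUndefinable_of_logFree

/-! #### The compositions, by landed names -/

/-- **(A) ∧ (R) ⟹ `ℝ` is not `∅`-definable in `ℂ_exp`** (C21 ∘ C20; `LogFreeOfCrux.real_not_definable_of_cruxes`). -/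
example (hA : RigidCore.AclSubsetLogFreeCore) (hR : RigidCore.SchanuelOnLogFreeCore) :
    ¬ Set.Definable₁ (∅ : Set ℂ) Literature.ModelTheory.ExponentialFields.Language.expRing
        (Set.range ((↑) : ℝ → ℂ)) :=
  stub_realUndefinable_of_logFree (stub_logFree_of_crux hR) hA

/-- **(R) ⟹ `ln 2 ∉ C_EA`**; **(A) ∧ (R) ⟹ `ln 2 ∉ dcl ∅`** and no branch of `log 2` in `acl ∅`
(landed `LogFreeOfCrux.*`). -/
example (hA : RigidCore.AclSubsetLogFreeCore) (hR : RigidCore.SchanuelOnLogFreeCore) (k : ℤ) :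
    ((Real.log 2 : ℝ) : ℂ) ∉ logFreeCore ∧ ((Real.log 2 : ℝ) : ℂ) ∉ expDcl ∧
      ((Real.log 2 : ℝ) : ℂ) + k * (2 * Real.pi * Complex.I) ∉ expAcl :=
  ⟨LogFreeOfCrux.log_two_not_mem_core_of_crux hR, LogFreeOfCrux.log_two_not_mem_expDcl_of_cruxes hA hR,
    LogFreeOfCrux.logTwoBranch_not_mem_expAcl_of_cruxes hA hR k⟩

/-- **The first layer is log-free with no hypothesis** (C19): for algebraic `α, β` the core point
`α + β·2πi` satisfies C20's conclusion unconditionally. -/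
example {α β : ℂ} (hα : IsAlgebraic ℚ α) (hβ : IsAlgebraic ℚ β)
    (h : IsAlgebraic ℚ (Complex.exp (α + β * (2 * ↑Real.pi * Complex.I)))) :
    α + β * (2 * ↑Real.pi * Complex.I) ∈ logFreeCore ∧
      α + β * (2 * ↑Real.pi * Complex.I) ∈ Submodule.span ℚ ({(2 * ↑Real.pi * Complex.I : ℂ)} : Set ℂ) := by
  obtain ⟨hα0, q, hq⟩ := stub_bakerLayerOne α β hα hβ h
  refine ⟨add_mem (logFreeCore_mem_coreFamily.2.2 _ (hα.tower_top (L := logFreeCore)))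
    (mul_mem (logFreeCore_mem_coreFamily.2.2 _ (hβ.tower_top (L := logFreeCore)))
      two_pi_I_mem_logFreeCore), ?_⟩
  rw [hα0, zero_add, ← hq]
  exact Submodule.mem_span_singleton.2 ⟨q, by rw [Rat.smul_def]⟩

/-- Transcendence form of C19 by its landed name: `e^{α + β·2πi} ∉ ℚ̄` when `α ≠ 0 ∨ β ∉ ℚ`. -/
example {α β : ℂ} (hα : IsAlgebraic ℚ α) (hβ : IsAlgebraic ℚ β)
    (h : α ≠ 0 ∨ β ∉ Set.range ((↑) : ℚ → ℂ)) :
    Transcendental ℚ (Complex.exp (α + β * (2 * ↑Real.pi * Complex.I))) :=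
  BakerLayerOne.exp_transcendental_of_layerOne hα hβ h

end LogFreeStubs

/-! ### Stubs C22–C24 (v23b, lead c12, wave 2) — ALL LANDED (v25) and imported above under their registered
names: Hermite–Lindemann RELATIVE TO THE KERNEL along the whole core — `(R) ⟹ for u ∈ C_EA ∖ ℚ·2πi, eᵘ is
transcendental over ℚ(2πi, u)` (C22, p162545; the `r = 1` content of every level of the tower, uniformly —
stronger than the rank-2 instance `(2πi, u)` of (R), which says nothing when `u ∉ ℚ(π)^{alg}`), hence no fixed
point of `exp` (C23, p162223) and no logarithm of `π` (C24, p162391) lies in `C_EA`. -/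

section CoreHLStubs

open Summit.Schanuel.Schanuel.Theorems.AclSubsetLogFreeCore.Negative

/-- **C22 `stub_coreHL_of_crux`** (lead; LANDED p162545 `…CoreHL.lean`): (R) ⟹ for `u ∈ C_EA`,
`eᵘ` algebraic over `ℚ(2πi, u)` ⟹ `u ∈ ℚ·2πi` (`CoreHL.level_zero/level_succ`: the C20 induction with the
base `ℚ(2πi, u) ≤ stage n`). [cite: Kirby2010, Prop. 7.2] -/
example :
    RigidCore.SchanuelOnLogFreeCore →
      ∀ u : ℂ, u ∈ logFreeCore →
        IsAlgebraic (↥(IntermediateField.adjoin ℚ ({(2 * ↑Real.pi * Complex.I : ℂ), u} : Set ℂ)))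
            (Complex.exp u) →
          u ∈ Submodule.span ℚ ({(2 * ↑Real.pi * Complex.I : ℂ)} : Set ℂ) :=
  stub_coreHL_of_crux

/-- **C23 `stub_fixedPoint_of_coreHL`** (wave 2, worker; LANDED p162223 `…FixedPointCoreHL.lean`): core HL
⟹ no fixed point of `exp` in `C_EA` (`e^{2πiq} ≠ 2πiq` by `|e^{2πiq}| = 1` and `irrational_pi`).
[cite: Marker2006] -/
example :
    (∀ u : ℂ, u ∈ logFreeCore →
        IsAlgebraic (↥(IntermediateField.adjoin ℚ ({(2 * ↑Real.pi * Complex.I : ℂ), u} : Set ℂ)))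
            (Complex.exp u) →
          u ∈ Submodule.span ℚ ({(2 * ↑Real.pi * Complex.I : ℂ)} : Set ℂ)) →
      ∀ u : ℂ, Complex.exp u = u → u ∉ logFreeCore :=
  stub_fixedPoint_of_coreHL

/-- **C24 `stub_logPi_of_coreHL`** (wave 2, worker; LANDED p162391 `…LogPiCoreHL.lean`): core HL ⟹ no
logarithm of `π` in `C_EA` (`π` is algebraic over `ℚ(2πi)`; `|e^{2πiq}| = 1 ≠ π`).
[cite: KirbyMacintyreOnshuus2012, p. 2] -/
example :
    (∀ u : ℂ, u ∈ logFreeCore →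
        IsAlgebraic (↥(IntermediateField.adjoin ℚ ({(2 * ↑Real.pi * Complex.I : ℂ), u} : Set ℂ)))
            (Complex.exp u) →
          u ∈ Submodule.span ℚ ({(2 * ↑Real.pi * Complex.I : ℂ)} : Set ℂ)) →
      ∀ u : ℂ, Complex.exp u = ↑Real.pi → u ∉ logFreeCore :=
  stub_logPi_of_coreHL

/-! #### The compositions, by landed names -/

/-- **(R) ⟹ core HL, transcendence form** (`CoreHL.exp_transcendental_of_crux`): for `u ∈ C_EA ∖ ℚ·2πi`,
`eᵘ ∉ ℚ(2πi, u)^{alg}`. -/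
example (hR : RigidCore.SchanuelOnLogFreeCore) {u : ℂ} (hu : u ∈ logFreeCore)
    (hnot : u ∉ Submodule.span ℚ ({(2 * ↑Real.pi * Complex.I : ℂ)} : Set ℂ)) :
    Transcendental (↥(IntermediateField.adjoin ℚ ({(2 * ↑Real.pi * Complex.I : ℂ), u} : Set ℂ)))
      (Complex.exp u) :=
  CoreHL.exp_transcendental_of_crux hR hu hnot

/-- **(R) ⟹ no fixed point of `exp` and no logarithm of `π` in `C_EA`; `eᵉ ∉ ℚ(2πi, e)^{alg}`**
(C23 ∘ C22, C24 ∘ C22, C22 at `e`). -/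
example (hR : RigidCore.SchanuelOnLogFreeCore) :
    (∀ u : ℂ, Complex.exp u = u → u ∉ logFreeCore) ∧
      (∀ u : ℂ, Complex.exp u = ↑Real.pi → u ∉ logFreeCore) ∧
      ((Real.log Real.pi : ℝ) : ℂ) ∉ logFreeCore ∧
      Transcendental
        (↥(IntermediateField.adjoin ℚ ({(2 * ↑Real.pi * Complex.I : ℂ), Complex.exp 1} : Set ℂ)))
        (Complex.exp (Complex.exp 1)) :=
  ⟨stub_fixedPoint_of_coreHL (stub_coreHL_of_crux hR), stub_logPi_of_coreHL (stub_coreHL_of_crux hR),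
    LogPiCoreHL.realLogPi_not_mem_core_of_coreHL (stub_coreHL_of_crux hR),
    CoreHL.exp_exp_one_transcendental_of_crux hR⟩

/-- **(A) ∧ (R) ⟹ no fixed point of `exp` is `∅`-algebraic in `ℂ_exp`** (no parameter-free formula
isolates a finite non-empty set of solutions of `eᶻ = z`: fixed-point indiscernibility, finite-set form)
**and a second route to `¬Def_∅(ℝ)`** (via `ln π`, `LogPiCoreHL.real_not_definable_of_coreHL_of_A`). -/
example (hA : RigidCore.AclSubsetLogFreeCore) (hR : RigidCore.SchanuelOnLogFreeCore) :
    (∀ u : ℂ, Complex.exp u = u → u ∉ expAcl) ∧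
      ¬ Set.Definable₁ (∅ : Set ℂ) Literature.ModelTheory.ExponentialFields.Language.expRing
        (Set.range ((↑) : ℝ → ℂ)) :=
  ⟨fun u hfix h => stub_fixedPoint_of_coreHL (stub_coreHL_of_crux hR) u hfix (aclSubsetLogFreeCore_iff.1 hA h),
    LogPiCoreHL.real_not_definable_of_coreHL_of_A (stub_coreHL_of_crux hR) hA⟩

/-- C20 is the special case `eᵘ ∈ ℚ̄` of C22 (`CoreHL.logFree_of_coreHL`, landed). -/
example (hR : RigidCore.SchanuelOnLogFreeCore) {u : ℂ} (hu : u ∈ logFreeCore)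
    (halg : IsAlgebraic ℚ (Complex.exp u)) :
    u ∈ Submodule.span ℚ ({(2 * ↑Real.pi * Complex.I : ℂ)} : Set ℂ) :=
  CoreHL.logFree_of_coreHL (stub_coreHL_of_crux hR) hu halg

end CoreHLStubs

/-! ### Stubs C25–C26 (v26, lead c12, wave 3) — BOTH LANDED (v27) and imported above under their registered
names: the two exponential towers — (R) ⟹ `π, e, eᵉ, e^{eᵉ}, …` are algebraically independent (C25, p163638:
the core tuple `(2πi, 1, e, …, exp^[n] 1)`, rank `n + 2`) and `π, e^π, e^{e^π}, …` are algebraically independent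
(C26, p163466: the core tuple `(2πi, π, e^π, …)`).  The crux thus contains the folklore conjectures "`eᵉ`, `e^{eᵉ}`,
`e^{e^π}` are transcendental" — unconditionally only the first TWO entries of each tower are known transcendental
(`e`, `π`; `e^π` Gel'fond; `π ⊥ e^π` Nesterenko), and not even the irrationality of `eᵉ` is known. -/

section TowerStubs

/-- **C25 `stub_expTower_of_crux`** (lead; LANDED p163638 `…ExpTower.lean`): (R) ⟹ `π, e, eᵉ, …, exp^[n] 1`
algebraically independent (index `0 ↦ π`, `k ≥ 1 ↦ exp^[k] 1`); `1` next to an algebraically independent family is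
linearly independent (`ExpTower.linearIndependent_cons_one`, monomial basis). [folklore] -/
example :
    RigidCore.SchanuelOnLogFreeCore →
      ∀ n : ℕ, AlgebraicIndependent ℚ
        (fun k : Fin (n + 1) => if (k : ℕ) = 0 then (Real.pi : ℂ) else Complex.exp^[(k : ℕ)] 1) :=
  stub_expTower_of_crux

/-- **C26 `stub_piTower_of_crux`** (wave 3, worker; LANDED p163466 `…PiTower.lean`): (R) ⟹
`π, e^π, e^{e^π}, …, exp^[n−1] π` algebraically independent. [folklore] -/
example :
    RigidCore.SchanuelOnLogFreeCore →
      ∀ n : ℕ, AlgebraicIndependent ℚ (fun k : Fin n => Complex.exp^[(k : ℕ)] (Real.pi : ℂ)) :=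
  stub_piTower_of_crux

/-- The photogenic instances by landed names: **(R) ⟹ `π, e, eᵉ` and `π, e^π, e^{e^π}` algebraically
independent; `eᵉ`, `e^{eᵉ}`, `e^{e^π}` transcendental.** -/
example (hR : RigidCore.SchanuelOnLogFreeCore) :
    AlgebraicIndependent ℚ ![(Real.pi : ℂ), Complex.exp 1, Complex.exp (Complex.exp 1)] ∧
      AlgebraicIndependent ℚ
        ![(Real.pi : ℂ), Complex.exp (Real.pi : ℂ), Complex.exp (Complex.exp (Real.pi : ℂ))] ∧
      Transcendental ℚ (Complex.exp (Complex.exp 1)) ∧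
      Transcendental ℚ (Complex.exp (Complex.exp (Complex.exp 1))) ∧
      Transcendental ℚ (Complex.exp (Complex.exp (Real.pi : ℂ))) :=
  ⟨ExpTower.pi_e_expE_of_crux hR, PiTower.pi_expPi_expExpPi_of_crux hR, ExpTower.transcendental_expE_of_crux hR,
    ExpTower.transcendental_expExpE_of_crux hR, PiTower.transcendental_expExpPi_of_crux hR⟩

end TowerStubs

/-! ### Calibrations C12–C15 (v21, lead c11): the Technical Hypothesis for the powers of `e` and for
the real powers of `π` from the tree's PROVED transcendence measures, and the unconditional instances of
Diaz's Theorem 2.7 (clause `t₂`, `Literature.Barriers.Schanuel.ceil_le_trdeg_gridField₂`, PROVED) on the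
power grids.  ALL LANDED (C12/C13/C16/C17/C18 by the lead, C14/C15 by wave-1 workers) and imported above under their
registered names (the `example`s below restate each registered signature verbatim and close it by the landed name). -/

/-- **C12 `stub_expOnePowersTH`** (lead; LANDED p156890, by its landed name): the powers `1, e, …, e^{d−1}` of `e = exp 1` satisfy the
Technical Hypothesis of Nesterenko–Philippon (LNM 1752, Ch. 14, Def. 2.6).  Source of the measure:
Nesterenko–Waldschmidt 1996, Thm 4 (2), PROVED in the tree
(`Literature.NumberTheory.Transcendental.NesterenkoWaldschmidt1996_thm_4_2_holds`); a polynomial lower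
bound in `∑ |hᵢ|` implies (T.H.) (`TechnicalHypothesis.of_lowerBound`).
[cite: NesterenkoWaldschmidt1996, Thm 4(2)] [cite: NesterenkoPhilippon2001, Ch. 14 Def. 2.6] -/
example :
    ∀ d : ℕ, Literature.Barriers.Schanuel.TechnicalHypothesis
      (fun i : Fin d => (Complex.exp 1) ^ (i : ℕ)) :=
  stub_expOnePowersTH

/-- **C13 `stub_expOneGridBound`** (lead; LANDED p156890, by its landed name): Diaz's Theorem 2.7 (clause `t₂`) made UNCONDITIONAL on the
grid `x = (eⁱ)_{i<d}`, `y = (eʲ)_{j<ℓ}`: for `d + ℓ < dℓ`,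
`⌈dℓ/(d+ℓ)⌉ ≤ trdeg_ℚ ℚ(e^{e^k} : k ≤ d + ℓ − 2)` (the field contains `e = e^{e⁰}`, all `eⁱ`, and all
`e^{xᵢyⱼ} = e^{e^{i+j}}`).  [cite: NesterenkoPhilippon2001, Ch. 14 Thm 2.7 (t₂)] -/
example :
    ∀ d l : ℕ, l + d < d * l →
      ((⌈((d * l : ℕ) : ℚ) / ((l + d : ℕ) : ℚ)⌉₊ : ℕ) : Cardinal) ≤
        Algebra.trdeg ℚ ↥(IntermediateField.adjoin ℚ
          (Set.range (fun k : Fin (d + l - 1) => Complex.exp ((Complex.exp 1) ^ (k : ℕ))))) :=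
  stub_expOneGridBound

/-- **C14 `stub_piRealPowersTH`** (wave 1, worker; LANDED p156937, by its landed name): the REAL powers `1, π, …, π^{d−1}` satisfy the
Technical Hypothesis (transcendence measure of `π` in fixed degree: Baker 1975, Ch. 3, Thm 3.1 /
p. 28 `|π − β| > B^{−C}`, PROVED in the tree as `baker1975_thm_3_1_holds`; lead c2 derived the
`2πi`-version `stub_piPowersTH`, p107393).
[cite: BakerTNT1975, Ch. 3 Thm 3.1 and p. 28] [cite: NesterenkoPhilippon2001, Ch. 14 Def. 2.6] -/
example :
    ∀ d : ℕ, Literature.Barriers.Schanuel.TechnicalHypothesis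
      (fun i : Fin d => (Real.pi : ℂ) ^ (i : ℕ)) :=
  stub_piRealPowersTH

/-- **C15 `stub_piRealGridBound`** (wave 1, worker; LANDED p157505, by its landed name; takes C14's statement as an explicit hypothesis):
Diaz's Theorem 2.7 (clause `t₂`) on the grid `x = (πⁱ)_{i<d}`, `y = (πʲ)_{j<ℓ}`: for `d + ℓ < dℓ`,
`⌈dℓ/(d+ℓ)⌉ ≤ trdeg_ℚ ℚ(π, e^{π^k} : k ≤ d + ℓ − 2)` — e.g. `(d, ℓ) = (4, 5)`:
`3 ≤ trdeg ℚ(π, e, e^π, e^{π²}, …, e^{π⁷})`.  [cite: NesterenkoPhilippon2001, Ch. 14 Thm 2.7 (t₂)] -/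
example :
    (∀ d : ℕ, Literature.Barriers.Schanuel.TechnicalHypothesis
      (fun i : Fin d => (Real.pi : ℂ) ^ (i : ℕ))) →
    ∀ d l : ℕ, l + d < d * l →
      ((⌈((d * l : ℕ) : ℚ) / ((l + d : ℕ) : ℚ)⌉₊ : ℕ) : Cardinal) ≤
        Algebra.trdeg ℚ ↥(IntermediateField.adjoin ℚ
          ({(Real.pi : ℂ)} ∪ Set.range (fun k : Fin (d + l - 1) => Complex.exp ((Real.pi : ℂ) ^ (k : ℕ))))) :=
  stub_piRealGridBound

/-- **C16 `stub_smallGridPowerCell`** (lead; LANDED p157024, by its landed name; the TH-free companion of C13/C15): Theorem 2.9 of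
LNM 1752, Ch. 14, clause `t₂` (`dℓ > d + ℓ`, NO Technical Hypothesis; PROVED in the tree as
`Literature.Barriers.Schanuel.smallTrdeg_thm_2_9_pos_holds`) on the grid `x = (1, u)`, `y = (1, u, u²)`:
for EVERY `u ∈ ℂ` with `1, u, u²` linearly independent over `ℚ`,
`2 ≤ trdeg_ℚ ℚ(u, e, e^u, e^{u²}, e^{u³})` — credit `2` on the 4-cell `(1, u, u², u³)` through every
transcendental core point. [cite: NesterenkoPhilippon2001, Ch. 14 Thm 2.9 (t₂)] -/
example :
    ∀ u : ℂ, LinearIndependent ℚ (fun i : Fin 3 => u ^ (i : ℕ)) →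
      ((2 : ℕ) : Cardinal) ≤ Algebra.trdeg ℚ ↥(IntermediateField.adjoin ℚ
        ({u} ∪ Set.range (fun k : Fin 4 => Complex.exp (u ^ (k : ℕ))))) :=
  stub_smallGridPowerCell

/-- **C17 `stub_expAlgPowersTH`** (lead; LANDED p157745, by its landed name): for every non-zero algebraic `β`, the powers
`1, e^β, …, e^{(d−1)β}` of the core point `e^β` satisfy the Technical Hypothesis — from the measure of
algebraic independence of M. Ably (1994) in one variable, PROVED in the tree
(`Literature.NumberTheory.Transcendental.Ably1994_lindemannWeierstrass_measure_holds`), a polynomial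
lower bound for fixed degree. [cite: Ably1994, Théorème p. 30] [cite: NesterenkoPhilippon2001, Ch. 14 Def. 2.6] -/
example :
    ∀ β : ℂ, IsAlgebraic ℚ β → β ≠ 0 → ∀ d : ℕ,
      Literature.Barriers.Schanuel.TechnicalHypothesis (fun i : Fin d => (Complex.exp β) ^ (i : ℕ)) :=
  stub_expAlgPowersTH

/-- **C18 `stub_expAlgGridBound`** (lead; LANDED p157745, by its landed name): Diaz's Theorem 2.7 (clause `t₂`) UNCONDITIONAL on the grid
`x = (e^{iβ})_{i<d}`, `y = (e^{jβ})_{j<ℓ}` for every non-zero algebraic `β`: for `d + ℓ < dℓ`,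
`⌈dℓ/(d+ℓ)⌉ ≤ trdeg ℚ(e^β, exp(e^{kβ}) : k ≤ d + ℓ − 2)`; e.g. three of
`e^β, e, e^{e^β}, e^{e^{2β}}, …, e^{e^{7β}}` are algebraically independent.  Generalises C13 (`β = 1`) to
infinitely many measured core points. [cite: NesterenkoPhilippon2001, Ch. 14 Thm 2.7 (t₂)] -/
example :
    ∀ β : ℂ, IsAlgebraic ℚ β → β ≠ 0 → ∀ d l : ℕ, l + d < d * l →
      ((⌈((d * l : ℕ) : ℚ) / ((l + d : ℕ) : ℚ)⌉₊ : ℕ) : Cardinal) ≤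
        Algebra.trdeg ℚ ↥(IntermediateField.adjoin ℚ ({Complex.exp β} ∪
          Set.range (fun k : Fin (d + l - 1) => Complex.exp ((Complex.exp β) ^ (k : ℕ))))) :=
  stub_expAlgGridBound

/-! #### The (R)-cells of C12–C18: power tuples of a transcendental core point (sorry-free glue) -/

namespace PowerCells

open Summit.Schanuel.Schanuel.Theorems.AclSubsetLogFreeCore.Negative

/-- Powers of a core point are core points. [folklore] -/
theorem pow_mem_logFreeCore {u : ℂ} (hu : u ∈ logFreeCore) (k : ℕ) : u ^ k ∈ logFreeCore :=
  pow_mem hu k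

/-- The powers `1, u, …, u^{N−1}` of a transcendental number are `ℚ`-linearly independent.
[folklore] -/
theorem linearIndependent_pow_of_transcendental {u : ℂ} (hu : Transcendental ℚ u) (N : ℕ) :
    LinearIndependent ℚ (fun k : Fin N => u ^ (k : ℕ)) := by
  rw [Fintype.linearIndependent_iff]
  intro g hg l
  set p : Polynomial ℚ := ∑ i : Fin N, Polynomial.monomial (i : ℕ) (g i) with hp
  have hpt : Polynomial.aeval u p = 0 := by
    simp only [hp, map_sum, Polynomial.aeval_monomial, ← Algebra.smul_def]
    exact hg
  have hp0 : p = 0 := by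
    by_contra hne
    exact hu ⟨p, hne, hpt⟩
  have hcoeff : p.coeff (l : ℕ) = g l := by
    simp only [hp, Polynomial.finsetSum_coeff, Polynomial.coeff_monomial]
    rw [Finset.sum_eq_single l]
    · simp
    · intro b _ hb
      rw [if_neg]
      exact fun h => hb (Fin.ext h)
    · intro h; exact absurd (Finset.mem_univ l) h
  rw [← hcoeff, hp0, Polynomial.coeff_zero]

/-- **(R) on the power tuple of a transcendental core point**: for `u ∈ C_EA` transcendental, the tuple
`z_N = (1, u, …, u^{N−1})` is a `ℚ`-free core tuple, so (R) demands `N ≤ trdeg ℚ(z_N, e^{z_N})`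
(the crux BY NAME). -/
theorem powers_demand_of_crux (hR : RigidCore.SchanuelOnLogFreeCore) {u : ℂ} (hu : u ∈ logFreeCore)
    (ht : Transcendental ℚ u) (N : ℕ) :
    (N : Cardinal) ≤ Algebra.trdeg ℚ
      ↥(IntermediateField.adjoin ℚ (Set.range (fun k : Fin N => u ^ (k : ℕ)) ∪
        Set.range (Complex.exp ∘ fun k : Fin N => u ^ (k : ℕ)))) :=
  hR N _ (fun k => pow_mem_logFreeCore hu k) (linearIndependent_pow_of_transcendental ht N)

/-- `e = exp 1` is a transcendental core point (Hermite; tree `transcendental_exp_holds`). -/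
theorem transcendental_exp_one : Transcendental ℚ (Complex.exp 1) :=
  Literature.NumberTheory.Transcendental.transcendental_exp_holds isAlgebraic_one one_ne_zero

/-- The explicit field of C13 sits inside the (R)-field of the cell `z_N = (e^k)_{k<N}`:
`ℚ(e^{e^k} : k < N) ≤ ℚ(z_N, e^{z_N})`. [folklore] -/
theorem adjoin_exp_pow_le (u : ℂ) (N : ℕ) :
    IntermediateField.adjoin ℚ (Set.range (fun k : Fin N => Complex.exp (u ^ (k : ℕ)))) ≤
      IntermediateField.adjoin ℚ (Set.range (fun k : Fin N => u ^ (k : ℕ)) ∪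
        Set.range (Complex.exp ∘ fun k : Fin N => u ^ (k : ℕ))) :=
  IntermediateField.adjoin.mono _ _ _ (by
    rintro _ ⟨k, rfl⟩
    exact Set.mem_union_right _ ⟨k, rfl⟩)

/-- Same with the base point adjoined (shape of C15): `ℚ(u, e^{u^k} : k < N) ≤ ℚ(z_N, e^{z_N})` for
`N ≥ 2` (`u = z_N 1`). [folklore] -/
theorem adjoin_insert_exp_pow_le (u : ℂ) {N : ℕ} (hN : 2 ≤ N) :
    IntermediateField.adjoin ℚ ({u} ∪ Set.range (fun k : Fin N => Complex.exp (u ^ (k : ℕ)))) ≤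
      IntermediateField.adjoin ℚ (Set.range (fun k : Fin N => u ^ (k : ℕ)) ∪
        Set.range (Complex.exp ∘ fun k : Fin N => u ^ (k : ℕ))) :=
  IntermediateField.adjoin.mono _ _ _ (by
    rintro z (rfl | ⟨k, rfl⟩)
    · exact Set.mem_union_left _ ⟨⟨1, by omega⟩, by simp⟩
    · exact Set.mem_union_right _ ⟨k, rfl⟩)

/-- **Unconditional credit on the `e`-power cells** (C13 transported into the (R)-field): for
`d + ℓ < dℓ`, `⌈dℓ/(d+ℓ)⌉ ≤ trdeg ℚ(z, e^z)` on `z = (e^k)_{k < d+ℓ−1}`, while (R) demands `d + ℓ − 1`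
(`powers_demand_of_crux`). -/
theorem expOnePowers_credit (d l : ℕ) (h : l + d < d * l) :
    ((⌈((d * l : ℕ) : ℚ) / ((l + d : ℕ) : ℚ)⌉₊ : ℕ) : Cardinal) ≤ Algebra.trdeg ℚ
      ↥(IntermediateField.adjoin ℚ (Set.range (fun k : Fin (d + l - 1) => (Complex.exp 1) ^ (k : ℕ)) ∪
        Set.range (Complex.exp ∘ fun k : Fin (d + l - 1) => (Complex.exp 1) ^ (k : ℕ)))) :=
  (stub_expOneGridBound d l h).trans
    (Literature.Barriers.Schanuel.trdeg_mono (adjoin_exp_pow_le _ _))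

/-- **Unconditional credit on the real `π`-power cells** (C15 ∘ C14 transported into the (R)-field). -/
theorem piRealPowers_credit (d l : ℕ) (h : l + d < d * l) :
    ((⌈((d * l : ℕ) : ℚ) / ((l + d : ℕ) : ℚ)⌉₊ : ℕ) : Cardinal) ≤ Algebra.trdeg ℚ
      ↥(IntermediateField.adjoin ℚ (Set.range (fun k : Fin (d + l - 1) => (Real.pi : ℂ) ^ (k : ℕ)) ∪
        Set.range (Complex.exp ∘ fun k : Fin (d + l - 1) => (Real.pi : ℂ) ^ (k : ℕ)))) := by
  have h2 : 2 ≤ d + l - 1 := by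
    have hd : 2 ≤ d := by
      by_contra hd
      interval_cases d <;> omega
    have hl : 2 ≤ l := by
      by_contra hl
      interval_cases l <;> omega
    omega
  exact (stub_piRealGridBound stub_piRealPowersTH d l h).trans
    (Literature.Barriers.Schanuel.trdeg_mono (adjoin_insert_exp_pow_le _ h2))

/-- The demand side on the same cells, by the crux's name: (R) asks for `d + ℓ − 1` on
`(e^k)_{k<d+ℓ−1}` … -/
theorem expOnePowers_demand_of_crux (hR : RigidCore.SchanuelOnLogFreeCore) (N : ℕ) :
    (N : Cardinal) ≤ Algebra.trdeg ℚ
      ↥(IntermediateField.adjoin ℚ (Set.range (fun k : Fin N => (Complex.exp 1) ^ (k : ℕ)) ∪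
        Set.range (Complex.exp ∘ fun k : Fin N => (Complex.exp 1) ^ (k : ℕ)))) :=
  powers_demand_of_crux hR DiazAnyBase.exp_one_mem_logFreeCore transcendental_exp_one N

/-- … and for `N` on `(π^k)_{k<N}`. -/
theorem piRealPowers_demand_of_crux (hR : RigidCore.SchanuelOnLogFreeCore) (N : ℕ) :
    (N : Cardinal) ≤ Algebra.trdeg ℚ
      ↥(IntermediateField.adjoin ℚ (Set.range (fun k : Fin N => (Real.pi : ℂ) ^ (k : ℕ)) ∪
        Set.range (Complex.exp ∘ fun k : Fin N => (Real.pi : ℂ) ^ (k : ℕ)))) :=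
  powers_demand_of_crux hR CalibrationR.pi_mem_logFreeCore CalibrationR.transcendental_pi_complex N

/-- **The small power cell through every transcendental core point** (C16 transported into the
(R)-field): for `u ∈ C_EA` transcendental, `2 ≤ trdeg ℚ(z, e^z)` on `z = (1, u, u², u³)` — demand `4`
(`powers_demand_of_crux`). -/
theorem smallGridPowerCell_credit {u : ℂ} (ht : Transcendental ℚ u) :
    ((2 : ℕ) : Cardinal) ≤ Algebra.trdeg ℚ
      ↥(IntermediateField.adjoin ℚ (Set.range (fun k : Fin 4 => u ^ (k : ℕ)) ∪
        Set.range (Complex.exp ∘ fun k : Fin 4 => u ^ (k : ℕ)))) :=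
  (stub_smallGridPowerCell u (linearIndependent_pow_of_transcendental ht 3)).trans
    (Literature.Barriers.Schanuel.trdeg_mono (adjoin_insert_exp_pow_le _ (by norm_num)))

/-- **Unconditional credit on the `e^β`-power cells** (C18 ∘ C17 transported into the (R)-field), every
non-zero algebraic `β`: `⌈dℓ/(d+ℓ)⌉ ≤ trdeg ℚ(z, e^z)` on `z = (e^{kβ})_{k<d+ℓ−1}`, demand `d + ℓ − 1`. -/
theorem expAlgPowers_credit {β : ℂ} (hβ : IsAlgebraic ℚ β) (hβ0 : β ≠ 0) (d l : ℕ) (h : l + d < d * l) :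
    ((⌈((d * l : ℕ) : ℚ) / ((l + d : ℕ) : ℚ)⌉₊ : ℕ) : Cardinal) ≤ Algebra.trdeg ℚ
      ↥(IntermediateField.adjoin ℚ (Set.range (fun k : Fin (d + l - 1) => (Complex.exp β) ^ (k : ℕ)) ∪
        Set.range (Complex.exp ∘ fun k : Fin (d + l - 1) => (Complex.exp β) ^ (k : ℕ)))) := by
  have h2 : 2 ≤ d + l - 1 := by
    have hd : 2 ≤ d := by
      by_contra hd
      interval_cases d <;> omega
    have hl : 2 ≤ l := by
      by_contra hl
      interval_cases l <;> omega
    omega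
  exact (stub_expAlgGridBound β hβ hβ0 d l h).trans
    (Literature.Barriers.Schanuel.trdeg_mono (adjoin_insert_exp_pow_le _ h2))

/-- … and the demand side for `(e^{kβ})_{k<N}` by the crux's name (`e^β ∈ C_EA` transcendental). -/
theorem expAlgPowers_demand_of_crux (hR : RigidCore.SchanuelOnLogFreeCore) {β : ℂ} (hβ : IsAlgebraic ℚ β)
    (hβ0 : β ≠ 0) (N : ℕ) :
    (N : Cardinal) ≤ Algebra.trdeg ℚ
      ↥(IntermediateField.adjoin ℚ (Set.range (fun k : Fin N => (Complex.exp β) ^ (k : ℕ)) ∪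
        Set.range (Complex.exp ∘ fun k : Fin N => (Complex.exp β) ^ (k : ℕ)))) :=
  powers_demand_of_crux hR
    (logFreeCore_mem_coreFamily.2.1 β
      (CalibrationB.kernelFreeCore_le_logFreeCore (mem_kernelFreeCore_of_isAlgebraic_rat hβ)))
    (Literature.NumberTheory.Transcendental.transcendental_exp_holds hβ hβ0) N

/-- Instance `(d, ℓ) = (4, 5)`: **three of `e, e^e, e^{e²}, …, e^{e⁷}` are algebraically independent**
(credit 3 on the 8-cell `(1, e, …, e⁷)`, demand 8). -/
example : ((3 : ℕ) : Cardinal) ≤ Algebra.trdeg ℚ ↥(IntermediateField.adjoin ℚ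
    (Set.range (fun k : Fin 8 => Complex.exp ((Complex.exp 1) ^ (k : ℕ))))) := by
  have h := stub_expOneGridBound 4 5 (by norm_num)
  norm_num at h
  exact h

/-- Instance `(d, ℓ) = (4, 5)` on the real powers of `π`: **`3 ≤ trdeg ℚ(π, e, e^π, e^{π²}, …, e^{π⁷})`**
(so not all of `e, e^{π²}, …, e^{π⁷}` are algebraic over Nesterenko's `ℚ(π, e^π)`). -/
example : ((3 : ℕ) : Cardinal) ≤ Algebra.trdeg ℚ ↥(IntermediateField.adjoin ℚ
    ({(Real.pi : ℂ)} ∪ Set.range (fun k : Fin 8 => Complex.exp ((Real.pi : ℂ) ^ (k : ℕ))))) := by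
  have h := stub_piRealGridBound stub_piRealPowersTH 4 5 (by norm_num)
  norm_num at h
  exact h

end PowerCells

/-! ### Calibrations C9–C11 (v19 → v20, lead c10): Nesterenko at every imaginary-axis CM point —
ALL THREE LANDED (wave 1 of this seat) and imported above under their registered names:
C9 `stub_nesterenkoImagAxis` (p154463, `…NesterenkoImagAxis.lean`, lead: `π ⊥ e^{π√d}` for every
`d ≥ 1`, with the period form `NesterenkoImagAxis.algebraicIndependent_pi_exp_period`),
C10 `stub_cruxCell_piI_of_re_sqrt` (p154223, `…CruxCellPiIOfReSqrt.lean`, worker),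
C11 `stub_cruxCell_through_pi_sqrt` (p154346, `…CruxCellThroughPiSqrt.lean`, worker). -/

/-- C9 by its landed name (p154463): `π ⊥ e^{π√d}` for every `d ≥ 1`. -/
example : ∀ d : ℕ, d ≠ 0 →
    AlgebraicIndependent ℚ ![(Real.pi : ℂ), Complex.exp ((Real.pi * Real.sqrt d : ℝ) : ℂ)] :=
  stub_nesterenkoImagAxis

/-- C9, period form, by its landed name: `π`, `e^{π√d}` and the scaling `c` of any algebraic
normalisation `cΛ_{i√d}` (a CM period) are algebraically independent. -/
example (d : ℕ) (hd : d ≠ 0) (τ : UpperHalfPlane) (hτ : (τ : ℂ) = Complex.I * (Real.sqrt d : ℝ))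
    (c : ℂ) (hc : c ≠ 0) (h₂ : IsAlgebraic ℚ ((PeriodPair.ofUpperHalfPlane τ).mulLeft c hc).g₂)
    (h₃ : IsAlgebraic ℚ ((PeriodPair.ofUpperHalfPlane τ).mulLeft c hc).g₃) :
    AlgebraicIndependent ℚ ![(Real.pi : ℂ), Complex.exp ((Real.pi * Real.sqrt d : ℝ) : ℂ), c] :=
  NesterenkoImagAxis.algebraicIndependent_pi_exp_period d hd τ hτ c hc h₂ h₃

/-- The C10 cells unconditionally (composition C10 ∘ C9): every pair `(πi, u)` with
`Re u ∈ ℚ*·π√d`, `d ≥ 1`, has `2 ≤ trdeg ℚ(x, e^x)`. -/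
theorem cruxCell_piI_of_re_sqrt (d : ℕ) (q : ℚ) (x : Fin 2 → ℂ) (hd : d ≠ 0) (hq : q ≠ 0)
    (h0 : x 0 = ↑Real.pi * Complex.I) (hre : (x 1).re = q * (Real.pi * Real.sqrt d)) :
    ((2 : ℕ) : Cardinal) ≤ Algebra.trdeg ℚ
      ↥(IntermediateField.adjoin ℚ (Set.range x ∪ Set.range (Complex.exp ∘ x))) :=
  stub_cruxCell_piI_of_re_sqrt stub_nesterenkoImagAxis d q x hd hq h0 hre

/-- The C11 cells unconditionally (composition C11 ∘ C9): every pair through `r·π√d`, `r ∈ ℚ*`,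
`d ≥ 1`, has `2 ≤ trdeg ℚ(x, e^x)`. -/
theorem cruxCell_through_pi_sqrt (d : ℕ) (r : ℚ) (x : Fin 2 → ℂ) (hd : d ≠ 0) (hr : r ≠ 0)
    (h0 : x 0 = (r : ℂ) * ((Real.pi * Real.sqrt d : ℝ) : ℂ)) :
    ((2 : ℕ) : Cardinal) ≤ Algebra.trdeg ℚ
      ↥(IntermediateField.adjoin ℚ (Set.range x ∪ Set.range (Complex.exp ∘ x))) :=
  stub_cruxCell_through_pi_sqrt stub_nesterenkoImagAxis d r x hd hr h0

/-- (R) at the C10/C11 cells asks for exactly `2` (they are `ℚ`-free core pairs when `u ∈ C_EA`):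
the demand side by the crux's name, for comparison (any `ℚ`-free core pair, e.g. `(πi, π√d)`). -/
theorem cruxDemand_rank_two (hR : RigidCore.SchanuelOnLogFreeCore)
    (x : Fin 2 → ℂ)
    (hx : ∀ i, x i ∈ (sInf {K : IntermediateField ℚ ℂ | (2 * ↑Real.pi * Complex.I : ℂ) ∈ K ∧
        (∀ w ∈ K, Complex.exp w ∈ K) ∧ ∀ w : ℂ, IsAlgebraic K w → w ∈ K} : IntermediateField ℚ ℂ))
    (hli : LinearIndependent ℚ x) :
    ((2 : ℕ) : Cardinal) ≤ Algebra.trdeg ℚ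
      ↥(IntermediateField.adjoin ℚ (Set.range x ∪ Set.range (Complex.exp ∘ x))) :=
  hR 2 x hx hli

/-- New settled cell (C10 ∘ C9 at `d = 2`, `q = 1`): the core pair `x = (πi, π√2)` —
`trdeg ℚ(πi, π√2, −1, e^{π√2}) ≥ 2`, i.e. `π ⊥ e^{π√2}`. -/
example :
    ((2 : ℕ) : Cardinal) ≤ Algebra.trdeg ℚ
      ↥(IntermediateField.adjoin ℚ
        (Set.range ![↑Real.pi * Complex.I, ((Real.pi * Real.sqrt 2 : ℝ) : ℂ)] ∪
          Set.range (Complex.exp ∘ ![↑Real.pi * Complex.I, ((Real.pi * Real.sqrt 2 : ℝ) : ℂ)]))) :=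
  cruxCell_piI_of_re_sqrt 2 1 _ two_ne_zero one_ne_zero rfl (by simp)

/-- New settled cell (C11 ∘ C9 at `d = 2`, `r = 1`): the core pair `x = (π√2, 1)` —
`trdeg ℚ(π√2, 1, e^{π√2}, e) ≥ 2` (while the pair `(πi, 1)`, i.e. `e ⊥ π`, is open). -/
example :
    ((2 : ℕ) : Cardinal) ≤ Algebra.trdeg ℚ
      ↥(IntermediateField.adjoin ℚ
        (Set.range ![((Real.pi * Real.sqrt 2 : ℝ) : ℂ), 1] ∪
          Set.range (Complex.exp ∘ ![((Real.pi * Real.sqrt 2 : ℝ) : ℂ), 1]))) :=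
  cruxCell_through_pi_sqrt 2 1 _ two_ne_zero one_ne_zero (by simp)



/-! ### Calibrations C6/C7 (c7, LANDED p145740 / p145934) by name, and the ladder's (R)-demand -/

/-- **The Gel'fond ladder as an (R)-cell** (v16's `diazLadder_demand_of_crux`, now by name over the
landed C7 `stub_diazLadder_coreCell`, p145934): (R) demands `d - 1 ≤ trdeg ℚ(x, e^x)` on the ladder
`x = (β^{k+1} · rπi)_{k < d-1}` (`deg β = d ≥ 2`, `r ∈ ℚ*`) — a core tuple, `ℚ`-free because it is
free even modulo `span_ℚ(ℚ̄ ∪ {πi})`.  Diaz supplies `⌊(d+1)/2⌋` of it unconditionally (C6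
`stub_diazLadderCount`, p145740). -/
theorem diazLadder_demand_of_crux (hR : RigidCore.SchanuelOnLogFreeCore)
    (β : ℂ) (r : ℚ) (d : ℕ) (hd : (minpoly ℚ β).natDegree = d) (h2 : 2 ≤ d) (hr : r ≠ 0)
    (x : Fin (d - 1) → ℂ) (hx : ∀ k, x k = β ^ ((k : ℕ) + 1) * ((r : ℂ) * (↑Real.pi * Complex.I))) :
    ((d - 1 : ℕ) : Cardinal) ≤ Algebra.trdeg ℚ
      ↥(IntermediateField.adjoin ℚ (Set.range x ∪ Set.range (Complex.exp ∘ x))) := by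
  obtain ⟨hmem, hfree⟩ := stub_diazLadder_coreCell β r d hd h2 hr x hx
  exact hR (d - 1) x hmem (hfree.of_comp _)

/-- Diaz's unconditional count on the same ladder, by its landed name (C6, p145740). -/
example (β : ℂ) (r : ℚ) (d : ℕ) (hd : (minpoly ℚ β).natDegree = d) (h2 : 2 ≤ d) (hr : r ≠ 0)
    (x : Fin (d - 1) → ℂ) (hx : ∀ k, x k = β ^ ((k : ℕ) + 1) * ((r : ℂ) * (↑Real.pi * Complex.I))) :
    (((d + 1) / 2 : ℕ) : Cardinal) ≤ Algebra.trdeg ℚ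
      ↥(IntermediateField.adjoin ℚ (Set.range x ∪ Set.range (Complex.exp ∘ x))) :=
  stub_diazLadderCount β r d hd h2 hr x hx

/-! ### Calibration C8 (v17) `stub_diazLadder_anyCoreBase` — LANDED p148947
(`Theorems/RigidCoreSchanuelOnLogFreeCoreDiazAnyBase.lean`, wave 1 of this seat, imported above under its
registered name): Diaz 1989 Corollaire 1 through every nonzero core point. -/

/-- C8 by its landed name (p148947): for `l ∈ C_EA ∖ {0}` and `deg_ℚ β = d ≥ 2`, the ladder
`x = (β^k · l)_{k < d}` is a `ℚ`-free core tuple with `⌊(d+1)/2⌋ ≤ trdeg ℚ(x, e^x)`. -/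
example :
    ∀ (β l : ℂ) (d : ℕ), (minpoly ℚ β).natDegree = d → 2 ≤ d →
      l ∈ (sInf {K : IntermediateField ℚ ℂ | (2 * ↑Real.pi * Complex.I : ℂ) ∈ K ∧
        (∀ w ∈ K, Complex.exp w ∈ K) ∧ ∀ w : ℂ, IsAlgebraic K w → w ∈ K} : IntermediateField ℚ ℂ) →
      l ≠ 0 →
      ∀ x : Fin d → ℂ, (∀ k, x k = β ^ (k : ℕ) * l) →
        (∀ k, x k ∈ (sInf {K : IntermediateField ℚ ℂ | (2 * ↑Real.pi * Complex.I : ℂ) ∈ K ∧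
          (∀ w ∈ K, Complex.exp w ∈ K) ∧ ∀ w : ℂ, IsAlgebraic K w → w ∈ K} : IntermediateField ℚ ℂ)) ∧
        LinearIndependent ℚ x ∧
        (((d + 1) / 2 : ℕ) : Cardinal) ≤ Algebra.trdeg ℚ
          ↥(IntermediateField.adjoin ℚ (Set.range x ∪ Set.range (Complex.exp ∘ x))) :=
  stub_diazLadder_anyCoreBase

/-- The concrete C8 cell by its landed name: `x = (e, ∛2·e, ∛4·e)` is a `ℚ`-free core triple with
`2 ≤ trdeg ℚ(x, e^x)` (two of `e^e, e^{∛2 e}, e^{∛4 e}` are algebraically independent; (R) demands 3;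
`e^e ∉ ℚ̄` itself is an open first cell of residue 2). -/
example := @DiazAnyBase.cruxCell_twoCpowThird_exp_one

/-- **The ladder through a core point as an (R)-cell**: (R) demands the full `d` on it
(composition of C8's bookkeeping half with the crux BY NAME). -/
theorem diazLadder_anyCoreBase_demand_of_crux (hR : RigidCore.SchanuelOnLogFreeCore)
    (β l : ℂ) (d : ℕ) (hd : (minpoly ℚ β).natDegree = d) (h2 : 2 ≤ d)
    (hl : l ∈ (sInf {K : IntermediateField ℚ ℂ | (2 * ↑Real.pi * Complex.I : ℂ) ∈ K ∧
        (∀ w ∈ K, Complex.exp w ∈ K) ∧ ∀ w : ℂ, IsAlgebraic K w → w ∈ K} : IntermediateField ℚ ℂ))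
    (hl0 : l ≠ 0) (x : Fin d → ℂ) (hx : ∀ k, x k = β ^ (k : ℕ) * l) :
    (d : Cardinal) ≤ Algebra.trdeg ℚ
      ↥(IntermediateField.adjoin ℚ (Set.range x ∪ Set.range (Complex.exp ∘ x))) := by
  obtain ⟨hmem, hfree, -⟩ := stub_diazLadder_anyCoreBase β l d hd h2 hl hl0 x hx
  exact hR d x hmem hfree

/-- The Diaz input of C8, by name (PROVED in the tree: Corollaire 1, arbitrary base). -/
example : Literature.NumberTheory.Transcendental.Diaz1989_cor1 :=
  Literature.NumberTheory.Transcendental.Diaz1989_cor1_holds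

/-- **Gel'fond 1949 as a settled rank-2 cell of (R)** (through neither `π` nor `πi`), by its landed
name: for `β` cubic and `r ∈ ℚ*`, the core pair `x = (βrπi, β²rπi)` has `2 ≤ trdeg ℚ(x, e^x)` — the
full (R)-demand (`d - 1 = 2 = ⌊(3+1)/2⌋`). -/
example (β : ℂ) (r : ℚ) (hd : (minpoly ℚ β).natDegree = 3) (hr : r ≠ 0)
    (x : Fin 2 → ℂ) (hx : ∀ k, x k = β ^ ((k : ℕ) + 1) * ((r : ℂ) * (↑Real.pi * Complex.I))) :
    (2 : Cardinal) ≤ Algebra.trdeg ℚ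
      ↥(IntermediateField.adjoin ℚ (Set.range x ∪ Set.range (Complex.exp ∘ x))) :=
  DiazLadder.cruxCell_gelfondCubic β r hd hr x hx

/-- The concrete settled cell `x = (2^{1/3}·rπi, 2^{2/3}·rπi)`, by its landed name. -/
example (r : ℚ) (hr : r ≠ 0) (x : Fin 2 → ℂ)
    (hx : ∀ k, x k = ((2 : ℂ) ^ (1 / 3 : ℂ)) ^ ((k : ℕ) + 1) * ((r : ℂ) * (↑Real.pi * Complex.I))) :
    (2 : Cardinal) ≤ Algebra.trdeg ℚ
      ↥(IntermediateField.adjoin ℚ (Set.range x ∪ Set.range (Complex.exp ∘ x))) :=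
  DiazLadder.cruxCell_twoCpowThird r hr x hx

/-! ### Sanity: the residues are the ledger items, the older forms feed them by landed names -/

/-- Residue 1 from the on-axes form of v6–v14 (reduction p140402 + engine p139838, packaged p140637). -/
example
    (hAx : ∀ (d : ℕ) (a : Fin d → ℂ), (∀ i, IsAlgebraic ℚ (a i)) →
      (∀ i, (a i).im = 0 ∨ (a i).re = 0) → LinearIndependent ℚ a →
      ((d + 1 : ℕ) : Cardinal) ≤ Algebra.trdeg ℚ
        ↥(IntermediateField.adjoin ℚ (insert (Real.pi : ℂ) (Set.range (Complex.exp ∘ a))))) :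
    GaussianStokesSector.PiFreeOverLWField :=
  AxesSplit.piFreeOverLWField_iff_onAxes.2 hAx

/-- Residue 1 is literally the sibling routes' item decl (stmt-Schanuel-9545). -/
example : ExceptionalSubspaces.PiFreeOverLWField := stub_piFreeOverLWField

/-- Residue 2 from item stmt-Schanuel-9548 verbatim (p137556). -/
example (hRel : GaussianStokesSector.RelSchanuelOverPiLWField) :
    ∀ (n : ℕ) (x : Fin n → ℂ),
      (∀ i, x i ∈ (sInf {K : IntermediateField ℚ ℂ | (2 * ↑Real.pi * Complex.I : ℂ) ∈ K ∧
        (∀ w ∈ K, Complex.exp w ∈ K) ∧ ∀ w : ℂ, IsAlgebraic K w → w ∈ K} : IntermediateField ℚ ℂ)) →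
      LinearIndependent ℚ ((Submodule.span ℚ ({z : ℂ | IsAlgebraic ℚ z} ∪ {(Real.pi : ℂ) * Complex.I})).mkQ ∘ x) →
      (n : Cardinal) ≤ Algebra.trdeg
        ↥(IntermediateField.adjoin ℚ ({z : ℂ | IsAlgebraic ℚ z} ∪ {(Real.pi : ℂ) * Complex.I} ∪ Complex.exp '' {z : ℂ | IsAlgebraic ℚ z}))
        ↥(IntermediateField.adjoin ↥(IntermediateField.adjoin ℚ ({z : ℂ | IsAlgebraic ℚ z} ∪ {(Real.pi : ℂ) * Complex.I} ∪ Complex.exp '' {z : ℂ | IsAlgebraic ℚ z})) (Set.range x ∪ Set.range (Complex.exp ∘ x))) :=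
  stub_coreRel_of_relSchanuel hRel

/-- Exactness of the split, by name (p138589): (R) ⟺ residue 1 ∧ residue 2. -/
example : RigidCore.SchanuelOnLogFreeCore ↔
    (GaussianStokesSector.PiFreeOverLWField ∧
      ∀ (n : ℕ) (x : Fin n → ℂ),
        (∀ i, x i ∈ (sInf {K : IntermediateField ℚ ℂ | (2 * ↑Real.pi * Complex.I : ℂ) ∈ K ∧
          (∀ w ∈ K, Complex.exp w ∈ K) ∧ ∀ w : ℂ, IsAlgebraic K w → w ∈ K} : IntermediateField ℚ ℂ)) →
        LinearIndependent ℚ ((Submodule.span ℚ ({z : ℂ | IsAlgebraic ℚ z} ∪ {(Real.pi : ℂ) * Complex.I})).mkQ ∘ x) →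
        (n : Cardinal) ≤ Algebra.trdeg
          ↥(IntermediateField.adjoin ℚ ({z : ℂ | IsAlgebraic ℚ z} ∪ {(Real.pi : ℂ) * Complex.I} ∪ Complex.exp '' {z : ℂ | IsAlgebraic ℚ z}))
          ↥(IntermediateField.adjoin ↥(IntermediateField.adjoin ℚ ({z : ℂ | IsAlgebraic ℚ z} ∪ {(Real.pi : ℂ) * Complex.I} ∪ Complex.exp '' {z : ℂ | IsAlgebraic ℚ z})) (Set.range x ∪ Set.range (Complex.exp ∘ x)))) :=
  stub_sectorSplitExact

/-- The Diaz input, by name (PROVED in the tree). -/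
example : Literature.NumberTheory.Transcendental.Diaz1989 :=
  Literature.NumberTheory.Transcendental.Diaz1989_holds

end Summit.Schanuel.Schanuel.Theorems.RigidCore

end
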